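import Literature.AlgebraicGeometry.Morphisms.AffineSpaceCompactification
import Literature.AlgebraicGeometry.Motives.GeneratingSectionsToProjRatios
import HarnessLib

/-!
# Points of projective space over a base: `𝐏(ι; S)(T) = 𝐏ⁿ_ℤ(T)`, and the uniqueness half of Hartshorne II 7.1

Topic `Literature/AlgebraicGeometry/Morphisms`; companion of `Morphisms/AffineSpaceCompactification`
(`Morphisms.projectiveSpace ι S = S ×_{Spec ℤ} 𝐏ⁿ_ℤ`, `n = #ι`) and of the chart-form treatment of
morphisms to projective space `Motives/MorphismsToProjectiveSpace` (`GeneratingSections.toProj`,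
Hartshorne II Thm. 7.1 (b): the morphism defined by generating sections `(U i, s_j/s_i)`),
`Motives/ProjectiveOfGeneratingSections` (`GeneratingSections.ofHom r`: the generating sections
`r^*𝒪(1)`, `r^*xᵢ` of a morphism `r`, II Thm. 7.1 (a)) and `Motives/GeneratingSectionsToProjRatios`
(`ofHom (D.toProj f)` has the ratios of `D`).

* `GeneratingSections.toProj_ofHom` — **the uniqueness half of Hartshorne II Thm. 7.1**: every
  `k`-morphism `r : Y → ℙ(ι)_k` IS the morphism defined by its own generating sections,
  `(ofHom r).toProj f = r` ("Let `φ : X → 𝐏ⁿ_A` […]. Then `𝓛 = φ^*𝒪(1)` is generated by the `sᵢ = φ^*xᵢ`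
  […] and `φ` is the unique `A`-morphism with this property"). With the tree's `ofHom_toProj_ratio`
  this makes `D ↦ D.toProj f` a surjection from generating-sections data onto `Hom_k(Y, ℙ(ι)_k)`
  whose fibres are the data with the same opens `Y_{sᵢ}` and ratios `s_j/s_i`
  (`toProj_surjective`, `toProj_eq_toProj_iff`-free form `eq_toProj_iff`): the functor of points of
  `ℙ(ι)_k` in the tree's invertible-sheaf-free currency (Görtz–Wedhorn I Thm. 13.33 / (13.8)).
* `projectiveSpace.homEquiv` — **`𝐏(ι; S)(T) = 𝐏ⁿ_ℤ(T)`**: for `T : Over S`, `S`-morphisms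
  `T → 𝐏(ι; S)` correspond to morphisms of schemes `T → 𝐏ⁿ_ℤ` (composition with the projection;
  `𝐏(ι; S)` is the product `S × 𝐏ⁿ_ℤ`), naturally in `T` (`homEquiv_naturality`); hence
  `S`-points of `𝐏(ι; S)` with values in `T` = generating-sections data on `T` indexed by
  `Fin (#ι + 1)` up to the above equivalence (`pointOfSections`, `pointOfSections_surjective`).
* `projectiveSpaceMap u : 𝐏(ι; S') → 𝐏(ι; S)` for `u : S' → S` and **`isPullback_projectiveSpaceMap`:
  `𝐏(ι; S') = S' ×_S 𝐏(ι; S)`** (projective space commutes with base change; Stacks 01NF,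
  Görtz–Wedhorn I (4.12) `ℙⁿ_S ×_S S' = ℙⁿ_{S'}`).

Everything is proved; no named facts.

## References

* R. Hartshorne, *Algebraic Geometry*, GTM 52 (1977): II Thm. 7.1, II §4 (`𝐏ⁿ_Y := 𝐏ⁿ_ℤ ×_ℤ Y`,
  p. 103). [Hartshorne1977]
* U. Görtz, T. Wedhorn, *Algebraic Geometry I*, 2nd ed. (2020): (4.12) `ℙⁿ_S`, (13.8), Thm. 13.33.
  [GortzWedhorn2020]
* The Stacks Project, Tag 01NF (Definition 27.13.2), Tag 01NE (Lemma 27.13.1, points of `𝐏ⁿ_ℤ`).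
  [StacksProject]
-/

noncomputable section

-- Mathlib's pull-back API is stated through `abbrev`s over `limit`; as in Mathlib's own
-- algebraic-geometry files we let `simp`/unification see through them.
set_option backward.isDefEq.respectTransparency false

universe u

open CategoryTheory CategoryTheory.Limits AlgebraicGeometry HomogeneousLocalization
open MvPolynomial (X)

attribute [local instance] MvPolynomial.gradedAlgebra

/-! ## The uniqueness half of Hartshorne II Thm. 7.1 -/

namespace Literature.AlgebraicGeometry.Motives

namespace GeneratingSections

open Literature.AlgebraicGeometry.Motives.Segre

variable {ι : Type} {k : Type u} [CommRing k] {Y : Scheme.{u}} (f : Y ⟶ Spec (.of k))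
  (r : Y ⟶ Proj (grading ι k)) (hr : r ≫ toSpec ι k = f)

include hr in
/-- The chart ring map of `ofHom r` at `i`, as a morphism of `CommRingCat`: the Mathlib section map
`(k[x]_{(xᵢ)})₀ → Γ(ℙ(ι), D₊(xᵢ))` followed by `r^* : Γ(ℙ(ι), D₊(xᵢ)) → Γ(Y, r⁻¹D₊(xᵢ))`.
[cite: Hartshorne1977, II Thm. 7.1 (a)] -/
theorem ofHom_sectionsRingHom_eq_comp (i : ι) :
    CommRingCat.ofHom ((ofHom r).sectionsRingHom f i) =
      Proj.awayToSection (grading ι k) (X i) ≫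
        r.appLE (Proj.basicOpen (grading ι k) (X i)) ((ofHom r).U i) le_rfl := by
  ext c
  exact sectionsRingHom_ofHom_eq_appLE f r hr i c

include hr in
/-- On the chart `r⁻¹D₊(xᵢ)`, the chart morphism of the data `ofHom r` is `r` itself.
[cite: Hartshorne1977, II Thm. 7.1 (b)] -/
theorem chart_ofHom (i : ι) : (ofHom r).chart f i = ((ofHom r).U i).ι ≫ r := by
  have h1 : (Proj.basicOpen (grading ι k) (X i)).toSpecΓ ≫
      Spec.map (Proj.awayToSection (grading ι k) (X i)) =
        (Proj.basicOpenIsoSpec (grading ι k) (X i) (X_mem k i) zero_lt_one).hom :=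
    (Proj.basicOpenIsoSpec_hom _ _ (X_mem k i) zero_lt_one).symm
  rw [chart_eq, ofHom_sectionsRingHom_eq_comp f r hr i, Spec.map_comp, Category.assoc,
    Scheme.Opens.toSpecΓ_SpecMap_appLE_assoc, chartι, Proj.awayι, reassoc_of% h1,
    Iso.hom_inv_id_assoc, Scheme.Hom.resLE_comp_ι]

include hr in
/-- **Uniqueness in Hartshorne II Thm. 7.1**: a `k`-morphism `r : Y → ℙ(ι)_k` is the morphism
defined (II 7.1 (b), `GeneratingSections.toProj`) by its own generating sections `r^*𝒪(1)`,
`sᵢ = r^*xᵢ` (II 7.1 (a), `GeneratingSections.ofHom`): "`φ` is the unique `A`-morphism with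
`𝓛 ≅ φ^*𝒪(1)`, `sᵢ = φ^*xᵢ`". [cite: Hartshorne1977, II Thm. 7.1] -/
theorem toProj_ofHom : (ofHom r).toProj f = r := by
  refine Scheme.Cover.hom_ext (ofHom r).cover _ _ fun i ↦ ?_
  rw [cover_f, ι_toProj, chart_ofHom f r hr]

/-- **Every `k`-morphism `Y → ℙ(ι)_k` is defined by generating sections** (surjectivity of
`D ↦ D.toProj f` onto `Hom_k(Y, ℙ(ι)_k)`; Hartshorne II Thm. 7.1, Görtz–Wedhorn I Thm. 13.33).
[cite: Hartshorne1977, II Thm. 7.1] -/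
theorem toProj_surjective :
    Function.Surjective (fun D : GeneratingSections ι Y ↦
      (⟨D.toProj f, D.toProj_toSpec f⟩ : {r : Y ⟶ Proj (grading ι k) // r ≫ toSpec ι k = f})) := by
  rintro ⟨r, hr⟩
  exact ⟨ofHom r, Subtype.ext (toProj_ofHom f r hr)⟩

include hr in
/-- A `k`-morphism `r : Y → ℙ(ι)_k` equals the morphism of the data `D` as soon as the data
`ofHom r` IS `D` (converse: `ofHom (D.toProj f)` has the opens and — restricted along the equality
of opens — the ratios of `D`, `GeneratingSections.ofHom_toProj_ratio`). [cite: Hartshorne1977, II Thm. 7.1] -/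
theorem eq_toProj_of_ofHom_eq (D : GeneratingSections ι Y) (h : ofHom r = D) : r = D.toProj f := by
  rw [← h, toProj_ofHom f r hr]

end GeneratingSections

end Literature.AlgebraicGeometry.Motives

/-! ## `𝐏(ι; S)(T) = 𝐏ⁿ_ℤ(T)` and base change of `𝐏(ι; S)` -/

namespace Literature.AlgebraicGeometry.Morphisms

namespace projectiveSpace

variable {ι : Type u} {S : Scheme.{u}}

/-- **`S`-morphisms `T → 𝐏(ι; S)` = morphisms of schemes `T → 𝐏ⁿ_ℤ`** (`𝐏(ι; S) = S × 𝐏ⁿ_ℤ`):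
compose with the projection; conversely pair with the structure map of `T`.
[cite: StacksProject, Tag 01NF] -/
def homEquiv (T : Over S) :
    (T ⟶ Over.mk (projectiveSpaceFst ι S)) ≃ (T.left ⟶ projectiveSpaceInt ι) where
  toFun g := g.left ≫ pullback.snd _ _
  invFun φ := Over.homMk (pullback.lift T.hom φ (terminal.hom_ext _ _)) (pullback.lift_fst _ _ _)
  left_inv g := by
    ext1
    refine pullback.hom_ext ?_ ?_
    · change pullback.lift T.hom (g.left ≫ pullback.snd _ _) _ ≫ pullback.fst _ _ =
        g.left ≫ pullback.fst _ _
      rw [pullback.lift_fst]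
      exact (Over.w g).symm
    · change pullback.lift T.hom (g.left ≫ pullback.snd _ _) _ ≫ pullback.snd _ _ =
        g.left ≫ pullback.snd _ _
      rw [pullback.lift_snd]
  right_inv φ := pullback.lift_snd _ _ _

/-- `homEquiv g = g ≫ pr_{𝐏ⁿ_ℤ}`. [cite: StacksProject, Tag 01NF] -/
theorem homEquiv_apply (T : Over S) (g : T ⟶ Over.mk (projectiveSpaceFst ι S)) :
    homEquiv T g = g.left ≫ pullback.snd _ _ := rfl

/-- The underlying morphism of `homEquiv.symm φ` is `(T → S, φ)`. [cite: StacksProject, Tag 01NF] -/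
theorem homEquiv_symm_apply_left (T : Over S) (φ : T.left ⟶ projectiveSpaceInt ι) :
    ((homEquiv T).symm φ).left = pullback.lift T.hom φ (terminal.hom_ext _ _) := rfl

/-- Naturality of `homEquiv` in `T`: `homEquiv (h ≫ g) = h ≫ homEquiv g`. [cite: StacksProject, Tag 01NF] -/
theorem homEquiv_naturality {T T' : Over S} (h : T' ⟶ T) (g : T ⟶ Over.mk (projectiveSpaceFst ι S)) :
    homEquiv T' (h ≫ g) = h.left ≫ homEquiv T g := by
  rw [homEquiv_apply, homEquiv_apply, Over.comp_left, Category.assoc]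

/-- **`S`-points of `𝐏(ι; S)` from generating sections**: generating-sections data on `T` (an
`S`-scheme) indexed by the `#ι + 1` homogeneous coordinates of `𝐏ⁿ_ℤ` define an `S`-morphism
`T → 𝐏(ι; S)` (Hartshorne II Thm. 7.1 (b) over `ℤ`, then `homEquiv`). [cite: Hartshorne1977, II Thm. 7.1 (b)] -/
def pointOfSections (T : Over S) (D : Motives.GeneratingSections (Fin (Nat.card ι + 1)) T.left) :
    T ⟶ Over.mk (projectiveSpaceFst ι S) :=
  (homEquiv T).symm (D.toProj (specULiftZIsTerminal.from T.left))

/-- The `𝐏ⁿ_ℤ`-component of `pointOfSections T D` is `D.toProj`. [cite: Hartshorne1977, II Thm. 7.1 (b)] -/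
theorem homEquiv_pointOfSections (T : Over S)
    (D : Motives.GeneratingSections (Fin (Nat.card ι + 1)) T.left) :
    homEquiv T (pointOfSections T D) = D.toProj (specULiftZIsTerminal.from T.left) :=
  (homEquiv T).apply_symm_apply _

/-- **Every `S`-morphism `T → 𝐏(ι; S)` comes from generating sections on `T`** (its own:
`ofHom` of its `𝐏ⁿ_ℤ`-component; Hartshorne II Thm. 7.1, uniqueness half `toProj_ofHom`).
[cite: Hartshorne1977, II Thm. 7.1] -/
theorem pointOfSections_surjective (T : Over S) :
    Function.Surjective (pointOfSections (ι := ι) T) := by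
  intro g
  refine ⟨Motives.GeneratingSections.ofHom (homEquiv T g), ?_⟩
  rw [pointOfSections, Equiv.symm_apply_eq]
  exact Motives.GeneratingSections.toProj_ofHom _ _ (specULiftZIsTerminal.hom_ext _ _)

end projectiveSpace

/-! ### Base change of `𝐏(ι; S)` -/

section BaseChange

variable (ι : Type u) {S S' : Scheme.{u}} (u : S' ⟶ S)

/-- The morphism `𝐏(ι; S') → 𝐏(ι; S)` over `u : S' → S` (`u × 𝟙` on `S' × 𝐏ⁿ_ℤ`).
[cite: StacksProject, Tag 01NF] -/
def projectiveSpaceMap : projectiveSpace ι S' ⟶ projectiveSpace ι S :=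
  pullback.map (terminal.from S') (terminal.from (projectiveSpaceInt ι)) (terminal.from S)
    (terminal.from (projectiveSpaceInt ι)) u (𝟙 _) (𝟙 _) (terminal.hom_ext _ _) (by simp)

/-- `projectiveSpaceMap u` lies over `u`. [cite: StacksProject, Tag 01NF] -/
@[reassoc]
theorem projectiveSpaceMap_fst :
    projectiveSpaceMap ι u ≫ projectiveSpaceFst ι S = projectiveSpaceFst ι S' ≫ u :=
  pullback.lift_fst _ _ _

/-- `projectiveSpaceMap u` commutes with the projections to `𝐏ⁿ_ℤ`. [cite: StacksProject, Tag 01NF] -/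
@[reassoc]
theorem projectiveSpaceMap_snd :
    projectiveSpaceMap ι u ≫ pullback.snd _ _ = pullback.snd _ _ := by
  rw [projectiveSpaceMap, pullback.lift_snd, Category.comp_id]

/-- **Projective space commutes with base change: `𝐏(ι; S') = S' ×_S 𝐏(ι; S)`** (Görtz–Wedhorn I
(4.12) `ℙⁿ_S ×_S S' = ℙⁿ_{S'}`; Stacks 01NF). [cite: StacksProject, Tag 01NF]
[cite: GortzWedhorn2020, Section (4.12)] -/
theorem isPullback_projectiveSpaceMap :
    IsPullback (projectiveSpaceMap ι u) (projectiveSpaceFst ι S') (projectiveSpaceFst ι S) u :=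
  IsPullback.of_right (h₁₁ := projectiveSpaceMap ι u)
    (by
      rw [projectiveSpaceMap_snd, terminal.comp_from]
      exact (IsPullback.of_hasPullback (terminal.from S') (terminal.from (projectiveSpaceInt ι))).flip)
    (projectiveSpaceMap_fst ι u)
    (IsPullback.of_hasPullback (terminal.from S) (terminal.from (projectiveSpaceInt ι))).flip

end BaseChange

/-! ### Over an AFFINE base: the coordinate opens of `𝐏(ι; S)` are affine, hence so are the non-vanishing
loci of generating sections that define a closed immersion `T ↪ 𝐏(ι; S)` (edition 2) -/

section AffineBase

namespace projectiveSpace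

variable {ι : Type u} {S : Scheme.{u}}

/-- The terminal scheme is affine (it is `Spec ℤ`). [folklore] -/
private theorem isAffine_terminal : IsAffine (⊤_ Scheme.{u}) :=
  IsAffine.of_isIso (terminalIsoIsTerminal specULiftZIsTerminal.{u}).hom

/-- **Over an affine base the projection `𝐏(ι; S) → 𝐏ⁿ_ℤ` is an affine morphism** (base change of
`S → Spec ℤ`, affine between affine schemes). [cite: GortzWedhorn2020, Section (4.12)] -/
theorem isAffineHom_snd [IsAffine S] :
    IsAffineHom (pullback.snd (terminal.from S) (terminal.from (projectiveSpaceInt ι))) := by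
  haveI := isAffine_terminal.{u}
  haveI : IsAffineHom (terminal.from S) := isAffineHom_of_isAffine _
  exact MorphismProperty.pullback_snd _ _ inferInstance

/-- **Over an affine base, the preimage in `𝐏(ι; S)` of an affine open of `𝐏ⁿ_ℤ` is affine**; in
particular the coordinate opens `S × D₊(x_j)` are affine (Hartshorne II §4: `𝐏ⁿ_{Spec A} = Proj A[x₀, …, xₙ]`
is covered by the affine `D₊(x_j)`). [cite: Hartshorne1977, II §4 Definition p. 103 (`𝐏ⁿ_Y`)]
[cite: GortzWedhorn2020, Section (4.12)] -/
theorem isAffineOpen_snd_preimage [IsAffine S] {U : (projectiveSpaceInt ι).Opens} (hU : IsAffineOpen U) :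
    IsAffineOpen (pullback.snd (terminal.from S) (terminal.from (projectiveSpaceInt ι)) ⁻¹ᵁ U) :=
  haveI := isAffineHom_snd (ι := ι) (S := S)
  hU.preimage _

/-- The coordinate open `D₊(x_j) ⊆ 𝐏ⁿ_ℤ` is affine. [cite: Hartshorne1977, II Prop. 2.5 (b)] -/
theorem isAffineOpen_basicOpen_X (j : Fin (Nat.card ι + 1)) :
    IsAffineOpen (Proj.basicOpen (grading ι) (X j)) :=
  Proj.isAffineOpen_basicOpen _ (X j) (Motives.ProjectiveSpace.X_mem (R := intU.{u}) j) zero_lt_one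

/-- **The non-vanishing locus `U j` of generating sections is the preimage of the coordinate open `S × D₊(x_j)`
under the `S`-point `T → 𝐏(ι; S)` they define** (Hartshorne II Thm. 7.1: `s_j = φ^* x_j`; ★
`GeneratingSections.toProj_preimage_basicOpen` read through `homEquiv`). [cite: Hartshorne1977, II Thm. 7.1 (b)] -/
theorem pointOfSections_left_preimage_snd_preimage_basicOpen (T : Over S)
    (D : Motives.GeneratingSections (Fin (Nat.card ι + 1)) T.left) (j : Fin (Nat.card ι + 1)) :
    (pointOfSections T D).left ⁻¹ᵁ
        (pullback.snd (terminal.from S) (terminal.from (projectiveSpaceInt ι)) ⁻¹ᵁ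
          Proj.basicOpen (grading ι) (X j)) = D.U j := by
  rw [← Scheme.Hom.comp_preimage, ← homEquiv_apply, homEquiv_pointOfSections]
  exact D.toProj_preimage_basicOpen _ j

/-- **Over an AFFINE base, generating sections whose `S`-point `T ↪ 𝐏(ι; S)` is a CLOSED IMMERSION have AFFINE
non-vanishing loci**: `U j = ψ⁻¹(S × D₊(x_j))` with `S × D₊(x_j)` affine and `ψ` affine (Hartshorne II §4 / Thm. 7.1:
a closed subscheme of `𝐏ⁿ_A` is covered by the affine pieces `X ∩ D₊(x_j) = X_{s_j}`).
[cite: Hartshorne1977, II Thm. 7.1 (b)] [cite: Hartshorne1977, II §4 Definition p. 103 (`𝐏ⁿ_Y`)] -/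
theorem isAffineOpen_U_of_isClosedImmersion_pointOfSections [IsAffine S] (T : Over S)
    (D : Motives.GeneratingSections (Fin (Nat.card ι + 1)) T.left)
    (h : IsClosedImmersion (pointOfSections T D).left) (j : Fin (Nat.card ι + 1)) :
    IsAffineOpen (D.U j) := by
  rw [← pointOfSections_left_preimage_snd_preimage_basicOpen T D j]
  exact (isAffineOpen_snd_preimage (isAffineOpen_basicOpen_X j)).preimage _

end projectiveSpace

end AffineBase

end Literature.AlgebraicGeometry.Morphisms

end
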